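import Mathlib
import Summits.AtomisticToContinuum.BoseEinsteinCondensation.Theses.BECFeynmanVortexArea

/-!
# Route `BECFeynmanVortexArea`, support item `NodalLemma` (stmt-AtomisticToContinuum-12605)

THE NODAL LEMMA (torus-sector form of Feynman's 1955 permutation-ring phase count): for `N` bosons
on the torus of side `L > 0` and `m ∈ ℤ³` with `¬ (∀ t, N ∣ m_t)`, every continuous
`F : (ℝ³)^N → ℂ` that is `Lℤ³`-periodic in each particle, permutation-symmetric and
Bloch-equivariant, `F(X + s𝟙) = e^{i(2π/L) m·s} F(X)`, has a zero.

Proof (degree count `m_t = N · w`). Suppose `F` vanishes nowhere. Configuration space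
`(ℝ³)^N` is a real normed space, hence simply connected and locally path connected, so `F` has a
continuous logarithm `g` (`Complex.exists_continuousOn_eqOn_exp_comp`, Mathlib's lifting
criterion for the covering map `exp`). Every continuous function `h` with `exp ∘ h ≡ 1` on a
preconnected set is constant (`nodalLemma_eq_of_exp_eq_one`). Applied three times:
* symmetry: `g (X ∘ σ) = g X` (the difference has `exp = 1` and vanishes at `X = 0`);
* periodicity: `g (Y + L e_t^{(j)}) - g Y = g (L e_t^{(j)}) - g 0 =: 2πi w_j` is independent of
  the base point `Y`, and `w_j = w_k` by symmetry (a transposition maps `L e_t^{(j)}` to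
  `L e_t^{(k)}`);
* Bloch law along the diagonal `u ↦ u L e_t 𝟙`, `u ∈ ℝ`: `g (L e_t 𝟙) - g 0 = 2πi m_t`.
Telescoping `L e_t 𝟙 = ∑_j L e_t^{(j)}` gives `2πi m_t = ∑_j 2πi w_j = 2πi N w`, so `N ∣ m_t`
for every `t` — contradicting the hypothesis (for `N = 0` the sum is empty and `m = 0`).

References: physics ancestor Feynman 1955 (Beale, *Statistical Mechanics* 3rd ed. 2011, §11.5
p. 336); sharpness for `N ∣ m` (nodeless boosts) Bloch, Phys. Rev. A 7 (1973) 2187. As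
mathematics this is folklore covering-space degree theory (maps to `ℂ \ {0}` from a simply
connected space lift through `exp`).
-/

noncomputable section

namespace Summit.AtomisticToContinuum.BoseEinsteinCondensation.Theorems

open Set

/-- **Discrete-valued logarithm differences are constant.** On a preconnected set `s`, a function
`h` continuous on `s` with `exp (h x) = 1` for all `x ∈ s` (so `h` takes values in `2πiℤ`) is
constant on `s`. [folklore] -/
theorem nodalLemma_eq_of_exp_eq_one {α : Type*} [TopologicalSpace α] {s : Set α}
    (hs : IsPreconnected s) {h : α → ℂ} (hh : ContinuousOn h s)
    (h1 : ∀ x ∈ s, Complex.exp (h x) = 1) {x y : α} (hx : x ∈ s) (hy : y ∈ s) :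
    h x = h y := by
  have key : ∀ z ∈ s, ∃ n : ℤ, h z = n * (2 * Real.pi * Complex.I) := fun z hz =>
    Complex.exp_eq_one_iff.1 (h1 z hz)
  -- the integer-valued continuous function `z ↦ re (h z / 2πi)`
  set d : α → ℝ := fun z => (h z / (2 * Real.pi * Complex.I)).re with hd_def
  have hd : ContinuousOn d s := Complex.continuous_re.comp_continuousOn (hh.div_const _)
  have hdval : ∀ z ∈ s, ∀ n : ℤ, h z = n * (2 * Real.pi * Complex.I) → d z = n := by
    intro z _ n hn
    simp only [hd_def, hn, mul_div_assoc, div_self Complex.two_pi_I_ne_zero, mul_one,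
      Complex.intCast_re]
  have hdT : MapsTo d s (range ((↑) : ℤ → ℝ)) := by
    intro z hz
    obtain ⟨n, hn⟩ := key z hz
    exact ⟨n, (hdval z hz n hn).symm⟩
  have hdeq : d x = d y :=
    hs.constant_of_mapsTo Int.isClosedEmbedding_coe_real.isEmbedding.isInducing.isDiscrete_range
      hd hdT hx hy
  obtain ⟨nx, hnx⟩ := key x hx
  obtain ⟨ny, hny⟩ := key y hy
  have hcast : (nx : ℝ) = ny := (hdval x hx nx hnx).symm.trans (hdeq.trans (hdval y hy ny hny))
  have hn : nx = ny := by exact_mod_cast hcast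
  rw [hnx, hny, hn]

/-- A transposition of the labels moves the single-particle displacement from slot `j` to slot
`k`: `Pi.single j c ∘ swap j k = Pi.single k c`. [folklore] -/
theorem nodalLemma_single_comp_swap {N : ℕ} {β : Type*} [Zero β] (j k : Fin N) (c : β) :
    (Pi.single j c : Fin N → β) ∘ (Equiv.swap j k) = Pi.single k c := by
  funext i
  simp only [Function.comp_apply]
  by_cases hik : i = k
  · subst hik
    simp
  · rw [Pi.single_eq_of_ne hik]
    by_cases hij : i = j
    · subst hij
      rw [Equiv.swap_apply_left, Pi.single_eq_of_ne (Ne.symm hik)]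
    · rw [Equiv.swap_apply_of_ne_of_ne hij hik, Pi.single_eq_of_ne hij]

/-- **`NodalLemma` holds** (settles stmt-AtomisticToContinuum-12605, exact route decl): for
`N` bosons on the torus of side `L > 0` and `m ∈ ℤ³` with `¬ ∀ t, N ∣ m t`, every continuous,
particle-wise `L`-periodic, permutation-symmetric, Bloch-equivariant `F : (ℝ³)^N → ℂ` has a zero.
Degree count through a continuous logarithm of a nowhere-vanishing `F` (see the module
docstring): Bloch gives winding `m_t` along the diagonal move by `L e_t`, periodicity and
symmetry give winding `N · w` along the concatenated single-particle moves, and the two agree in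
the simply connected configuration space. [folklore] -/
theorem nodalLemma_proof :
    Summit.AtomisticToContinuum.BoseEinsteinCondensation.Theses.BECFeynmanVortexArea.NodalLemma := by
  unfold Summit.AtomisticToContinuum.BoseEinsteinCondensation.Theses.BECFeynmanVortexArea.NodalLemma
  intro N L hL m hm F hF hper hsym hbloch
  by_contra hne
  push Not at hne
  -- Step 1: a global continuous logarithm of `F` on the simply connected space `(ℝ³)^N`.
  obtain ⟨g, hg, hgF⟩ : ∃ g : (Fin N → EuclideanSpace ℝ (Fin 3)) → ℂ,
      Continuous g ∧ ∀ X, Complex.exp (g X) = F X := by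
    have hsc : IsSimplyConnected (univ : Set (Fin N → EuclideanSpace ℝ (Fin 3))) := by
      have : ContractibleSpace (univ : Set (Fin N → EuclideanSpace ℝ (Fin 3))) :=
        (convex_univ).contractibleSpace ⟨0, trivial⟩
      change SimplyConnectedSpace (univ : Set (Fin N → EuclideanSpace ℝ (Fin 3)))
      infer_instance
    obtain ⟨g, hg, hgF⟩ := Complex.exists_continuousOn_eqOn_exp_comp hsc isOpen_univ
      hF.continuousOn (by simpa using hne)
    exact ⟨g, continuousOn_univ.1 hg, fun X => hgF (mem_univ X)⟩
  have hpre : IsPreconnected (univ : Set (Fin N → EuclideanSpace ℝ (Fin 3))) :=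
    convex_univ.isPreconnected
  apply hm
  intro t
  -- the single-particle displacement `c = L e_t` and the diagonal displacement `v = L e_t 𝟙`
  obtain ⟨c, hc⟩ : ∃ c : EuclideanSpace ℝ (Fin 3), c = EuclideanSpace.single t L := ⟨_, rfl⟩
  obtain ⟨v, hv⟩ : ∃ v : Fin N → EuclideanSpace ℝ (Fin 3), v = fun _ => c := ⟨_, rfl⟩
  have hper' : ∀ (X : Fin N → EuclideanSpace ℝ (Fin 3)) (i : Fin N),
      F (X + Pi.single i c) = F X := fun X i => by rw [hc]; exact hper X i t
  -- Step 2: symmetry of the logarithm.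
  have hsymg : ∀ (σ : Equiv.Perm (Fin N)) (X : Fin N → EuclideanSpace ℝ (Fin 3)),
      g (X ∘ σ) = g X := by
    intro σ X
    have hcont : Continuous fun Y : Fin N → EuclideanSpace ℝ (Fin 3) => g (Y ∘ σ) - g Y :=
      (hg.comp (continuous_pi fun i => continuous_apply (σ i))).sub hg
    have h1 : ∀ Y : Fin N → EuclideanSpace ℝ (Fin 3), Complex.exp (g (Y ∘ σ) - g Y) = 1 := by
      intro Y
      rw [Complex.exp_sub, hgF, hgF, hsym, div_self (hne Y)]
    have key := nodalLemma_eq_of_exp_eq_one hpre hcont.continuousOn (fun Y _ => h1 Y) (mem_univ X)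
      (mem_univ 0)
    have h0 : ((0 : Fin N → EuclideanSpace ℝ (Fin 3)) ∘ σ) = 0 := rfl
    rw [h0, sub_self, sub_eq_zero] at key
    exact key
  -- Step 3: periodicity: the winding of one particle around direction `t` is base-point free.
  have hperg : ∀ (j : Fin N) (Y : Fin N → EuclideanSpace ℝ (Fin 3)),
      g (Y + Pi.single j c) - g Y = g (Pi.single j c) - g 0 := by
    intro j Y
    have hcont : Continuous fun Y : Fin N → EuclideanSpace ℝ (Fin 3) =>
        g (Y + Pi.single j c) - g Y := by
      fun_prop
    have h1 : ∀ Y : Fin N → EuclideanSpace ℝ (Fin 3),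
        Complex.exp (g (Y + Pi.single j c) - g Y) = 1 := by
      intro Y
      rw [Complex.exp_sub, hgF, hgF, hper', div_self (hne Y)]
    have key := nodalLemma_eq_of_exp_eq_one hpre hcont.continuousOn (fun Y _ => h1 Y) (mem_univ Y)
      (mem_univ 0)
    rwa [zero_add] at key
  -- Step 4: Bloch law along the diagonal: total phase `2π m_t`.
  have hphase : ∀ u : ℝ, F (u • v) =
      Complex.exp ((u : ℂ) * ((m t : ℂ) * (2 * Real.pi * Complex.I))) * F 0 := by
    intro u
    have h := hbloch (u • c) 0
    have e1 : (fun i => (0 : Fin N → EuclideanSpace ℝ (Fin 3)) i + u • c) = u • v := by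
      rw [hv]; funext i; simp
    have hsumeq : (∑ x : Fin 3, 2 * Real.pi / L * (m x : ℝ) * (u • c) x)
        = 2 * Real.pi * (m t) * u := by
      simp only [hc, PiLp.smul_apply, PiLp.single_apply, smul_eq_mul, mul_ite, mul_zero,
        Finset.sum_ite_eq', Finset.mem_univ, if_true]
      field_simp
    rw [e1, hsumeq] at h
    rw [h]
    congr 2
    push_cast
    ring
  have hblochg : g v - g 0 = (m t : ℂ) * (2 * Real.pi * Complex.I) := by
    have hcont : Continuous fun u : ℝ =>
        g (u • v) - g 0 - (u : ℂ) * ((m t : ℂ) * (2 * Real.pi * Complex.I)) :=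
      ((hg.comp (continuous_id.smul continuous_const)).sub continuous_const).sub
        (Complex.continuous_ofReal.mul continuous_const)
    have h1 : ∀ u : ℝ, Complex.exp
        (g (u • v) - g 0 - (u : ℂ) * ((m t : ℂ) * (2 * Real.pi * Complex.I))) = 1 := by
      intro u
      rw [Complex.exp_sub, Complex.exp_sub, hgF, hgF, hphase u, mul_div_assoc, div_self (hne 0),
        mul_one, div_self (Complex.exp_ne_zero _)]
    have key := nodalLemma_eq_of_exp_eq_one isPreconnected_univ hcont.continuousOn (fun u _ => h1 u)
      (mem_univ (1 : ℝ)) (mem_univ (0 : ℝ))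
    simp only [one_smul, zero_smul, Complex.ofReal_one, one_mul, Complex.ofReal_zero, zero_mul,
      sub_self] at key
    exact sub_eq_zero.1 key
  -- Step 5: telescoping the diagonal move into the `N` single-particle moves.
  have htel : ∀ S : Finset (Fin N),
      g (∑ j ∈ S, Pi.single j c) - g 0 = ∑ j ∈ S, (g (Pi.single j c) - g 0) := by
    intro S
    induction S using Finset.induction_on with
    | empty => simp
    | insert j S hj ih =>
      rw [Finset.sum_insert hj, Finset.sum_insert hj, ← ih,
        add_comm (Pi.single j c : Fin N → EuclideanSpace ℝ (Fin 3)) _,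
        ← hperg j (∑ x ∈ S, Pi.single x c)]
      ring
  have hvsum : (∑ j : Fin N, Pi.single j c : Fin N → EuclideanSpace ℝ (Fin 3)) = v := by
    rw [hv]; exact Finset.univ_sum_single _
  have hsum : g v - g 0 = ∑ j : Fin N, (g (Pi.single j c) - g 0) := by
    rw [← htel, hvsum]
  -- Step 6: all single-particle windings agree (symmetry under a transposition).
  have hw : ∀ j k : Fin N, g (Pi.single k c) - g 0 = g (Pi.single j c) - g 0 := by
    intro j k
    rw [← nodalLemma_single_comp_swap j k c, hsymg]
  -- Step 7: conclude `N ∣ m t`.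
  rcases Nat.eq_zero_or_pos N with hN | hN
  · subst hN
    have h0 : g v - g 0 = 0 := by rw [hsum]; simp
    rw [h0] at hblochg
    have hmt : (m t : ℂ) = 0 := by
      rcases mul_eq_zero.1 hblochg.symm with h | h
      · exact h
      · exact absurd h Complex.two_pi_I_ne_zero
    have hmt' : m t = 0 := by exact_mod_cast hmt
    simp [hmt']
  · set j₀ : Fin N := ⟨0, hN⟩ with hj₀
    obtain ⟨n₀, hn₀⟩ : ∃ n₀ : ℤ, g (Pi.single j₀ c) - g 0 = n₀ * (2 * Real.pi * Complex.I) := by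
      refine Complex.exp_eq_one_iff.1 ?_
      have hp := hper' 0 j₀
      rw [zero_add] at hp
      rw [Complex.exp_sub, hgF, hgF, hp, div_self (hne 0)]
    have htot : g v - g 0 = (N : ℂ) * (n₀ * (2 * Real.pi * Complex.I)) := by
      rw [hsum, Finset.sum_congr rfl fun j _ => hw j₀ j, Finset.sum_const, Finset.card_univ,
        Fintype.card_fin, hn₀, nsmul_eq_mul]
    rw [htot] at hblochg
    have hmt : (m t : ℂ) = (N : ℂ) * n₀ := by
      apply mul_right_cancel₀ Complex.two_pi_I_ne_zero
      rw [← hblochg]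
      ring
    exact ⟨n₀, by exact_mod_cast hmt⟩

end Summit.AtomisticToContinuum.BoseEinsteinCondensation.Theorems

end
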